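import Literature.AnabelianGeometry.SemiGraphs.TemperedSpecialFibre
import Literature.AnabelianGeometry.SemiGraphs.TemperedDecompositionCompact
import Literature.AnabelianGeometry.SemiGraphs.TemperedVerticialNamedFactsProofs
import Literature.AnabelianGeometry.SemiGraphs.Prop36HypothesesWitnessChart
import Literature.AnabelianGeometry.AbsoluteAnabelian.SlimTransport
import HarnessLib

/-!
# [SemiAnbd] Ex 3.10 / Cor 3.11: the special-fibre datum `SpecialFibreData` is INHABITED (abc-iut L3
# inhabitation census v1, row `SpecialFibreData`: zero producers)

Mochizuki, *Semi-graphs of anabelioids*, Publ. RIMS **42** (2006), §3, Example 3.10 (p. 44; PRIMS p. 270)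
and Corollary 3.11 (p. 45) [cite: MochizukiSemiAnbd2006, Ex 3.10 p.44]: "the semi-graph of anabelioids with
compact structure `𝒢^c` of the geometric special fibre … satisfies the hypotheses of Theorem 3.7", "the
natural quotient `Δ ↠ π₁^temp(𝒢) ≅ π₁^temp(𝒢^c)`".  abc-iut-L3-t2's record `SpecialFibreData D`
(`TemperedSpecialFibre.lean`): a Thm-3.7 graph `Gc`, a tempered chart of it, and a continuous SURJECTION
`D.delta ↠ π₁^temp(Gc)` — the hypothesis data of the cone FACT `Cor311` (F-1721) and of the Ex 3.10 rows.
It had no producer (INHABITATION-CENSUS-L3-v1 §A1).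

PROOF-ONLY file (abc-iut cell, wave-4 prover abc-iut-w4-d098; no `def`/`instance`/`structure`).  WITNESS,
HONESTLY LABELLED («self model»): for ANY semi-graph of anabelioids `𝒢` satisfying the hypotheses of
Thm 3.7 with a tempered chart `c` (the tree has such: abc-iut-w5-d212's `affWitness`, with chart, via
`exists_thm37Hypotheses_and_chart`) and ANY algebraically closed field `K`, the tempered arithmetic group
`D` with `Π := π₁^temp(𝒢)` (tempered: the chart; temp-slim: Prop 3.6 (iv) `temperedPiSlim_holds`,
abc-iut-L3-t11/d2; Galois-countable: the chart) over `K` (so `G_K = 1`, `Δ = Π`) carries the special-fibre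
datum `(𝒢, c, Δ = Π ⥲ π₁^temp(𝒢))`.  This is the honest content «a Thm-3.7 graph IS the special fibre of the
arithmetic group given by its own tempered fundamental group over an algebraically closed base»; it is NOT
a stable curve (no origin certificate `SpecialFibreOrigin` is — or can be — produced under campaign M).
Nothing here bears on [IUTchIII] Cor. 3.12.
-/

noncomputable section

namespace Literature.AnabelianGeometry.SemiGraphs

open Literature.AlgebraicGeometry.Frobenioids Literature.AnabelianGeometry.AbsoluteAnabelian

universe u

/-- Over an algebraically closed field the absolute Galois group is trivial. [folklore] -/
private theorem subsingleton_absoluteGaloisGroup_of_isAlgClosed (K : Type u) [Field K] [IsAlgClosed K] :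
    Subsingleton (Field.absoluteGaloisGroup K) := by
  refine ⟨fun σ τ => AlgEquiv.ext fun x => ?_⟩
  obtain ⟨k, rfl⟩ :=
    (IsAlgClosed.algebraMap_bijective_of_isIntegral (k := K) (K := AlgebraicClosure K)).2 x
  rw [AlgEquiv.commutes, AlgEquiv.commutes]

/-- **`SpecialFibreData` is inhabited («self model»).**  For a semi-graph of anabelioids `𝒢` satisfying the
hypotheses of Thm 3.7, a tempered chart `c` of `𝒢`, and an algebraically closed field `K` (universe-matched),
there is a tempered arithmetic group `D` over `K` — `Π := π₁^temp(𝒢)` itself, `G_K = 1`, `Δ = Π` — together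
with a special-fibre datum whose graph is `𝒢`, whose chart is `c`, and whose admissible quotient `Δ ↠ π₁^temp(𝒢)`
is the identity.  Inputs BY NAME: `temperedPiSlim_holds` (Prop 3.6 (iv): `π₁^temp` is temp-slim),
`IsTempered.subgroup_of_isClosed`, `isSlimGroup_congr`. [cite: MochizukiSemiAnbd2006, Ex 3.10 p.44] -/
theorem SpecialFibreData.exists_selfModel (𝒢 : ProfiniteSemiGraph.{u}) (h37 : 𝒢.Thm37Hypotheses)
    (c : ProfiniteSemiGraph.TemperedPiChart 𝒢) (K : Type u) [Field K] [IsAlgClosed K] :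
    ∃ D : TemperedArithmeticGroup K, Nonempty (SpecialFibreData D) := by
  haveI : Subsingleton (Field.absoluteGaloisGroup K) := subsingleton_absoluteGaloisGroup_of_isAlgClosed K
  haveI : SecondCountableTopology c.G := c.secondCountableTopology
  haveI : T2Space c.G := c.isTempered.t2Space
  have hslim : IsSlimGroup c.G := ProfiniteSemiGraph.temperedPiSlim_holds 𝒢 h37.toProp36Hypotheses c
  -- the trivial augmentation `Π → G_K = 1`
  let aug : c.G →ₜ* Field.absoluteGaloisGroup K :=
    { toMonoidHom := 1, continuous_toFun := continuous_const }
  have hker : aug.toMonoidHom.ker = ⊤ := by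
    ext g; simp [aug]
  -- `Δ = Π` as topological groups
  let eTop : (⊤ : Subgroup c.G) ≃ₜ* c.G :=
    { Subgroup.topEquiv with
      continuous_toFun := continuous_subtype_val
      continuous_invFun := by
        change Continuous fun g : c.G => (⟨g, Subgroup.mem_top g⟩ : (⊤ : Subgroup c.G))
        exact continuous_id.subtype_mk _ }
  have hΔtemp : IsTempered aug.toMonoidHom.ker := by
    rw [hker]; exact c.isTempered.subgroup_of_isClosed ⊤ (by rw [Subgroup.coe_top]; exact isClosed_univ)
  have hΔslim : IsSlimGroup aug.toMonoidHom.ker := by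
    rw [hker]; exact (isSlimGroup_congr eTop).mpr hslim
  let D : TemperedArithmeticGroup K :=
    { Pi := c.G
      isTempered := c.isTempered
      aug := aug
      aug_surjective := fun g => ⟨1, Subsingleton.elim _ _⟩
      isTempered_ker := hΔtemp
      isSlimGroup := hslim
      isSlimGroup_ker := hΔslim
      secondCountableTopology := c.secondCountableTopology }
  -- the admissible quotient `Δ ↪ Π = π₁^temp(𝒢)` (an isomorphism here)
  let adm : D.delta →ₜ* c.G :=
    { toMonoidHom := D.delta.subtype, continuous_toFun := continuous_subtype_val }
  refine ⟨D, ⟨{ Gc := 𝒢, hyp := h37, chart := c, admissible := adm, admissible_surjective := ?_ }⟩⟩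
  intro g
  have hg : g ∈ D.delta := by
    change g ∈ aug.toMonoidHom.ker
    rw [hker]; exact Subgroup.mem_top g
  exact ⟨⟨g, hg⟩, rfl⟩

/-- **Outright existence**: some tempered arithmetic group (over `ℚ̄`) carries a special-fibre datum — the
self model over abc-iut-w5-d212's Thm-3.7 witness graph `affWitness 2` with its chart
(`exists_thm37Hypotheses_and_chart`). [cite: MochizukiSemiAnbd2006, Ex 3.10 p.44] -/
theorem SpecialFibreData.exists_model :
    ∃ (D : TemperedArithmeticGroup (AlgebraicClosure ℚ)), Nonempty (SpecialFibreData D) := by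
  obtain ⟨𝒢, h37, ⟨c⟩⟩ := ProfiniteSemiGraph.exists_thm37Hypotheses_and_chart
  exact SpecialFibreData.exists_selfModel 𝒢 h37 c (AlgebraicClosure ℚ)

end Literature.AnabelianGeometry.SemiGraphs

end
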